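import Summits.QuantumFields.YangMills.Theorems.LuscherReductionTwistedTraceScalingBTDiagonalPhase
import HarnessLib

/-!
# Second DIFFERENCES of the transported kinetic step between the slow manifold `constLift u` and the vacuum `1`: the anharmonic remainder of
# `X_p(W; constLift u)` minus that of `X_p(W; 1)` is `O(τ_u·τ²)`, not `O(τ²)`
# (route `FlatTubeReduction`, crux K1 `NearFlatRatioLaw` stmt-QuantumFields-24720; seat `ym-line-ftr-p1` g13; rate twin «ratepack-v3 / frozen fibres»; R2b1 RECORD rung — no summit
# statement is proved here)

WHY (memo `Cruxes/NearFlatRatioLaw/Lines/ratepack-v3-frozen-g12.md` §5.4 and this generation's §6).  The exact dressing `W(u)² = f(u)/f(1)` of the rate twin must be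
two-sided QUADRATICALLY in the slow amplitude, `|W² − 1| ≤ κ_W·d(u)² + O(λ_b²)`.  Lane A's pointwise bound `abs_diagX_sub_diagX1_le` of the second-order part of the diagonal
Laplace exponent carries the `u`-INDEPENDENT anharmonic junk `β·stepActionErr τ 0 ∍ β·N_P·29376τ³` (the cubic remainder of the magnetic action at `u = 1` AND at `u`,
bounded separately), whose Gaussian moment is `O(β^{-1/2}) ≫ λ_b²`: affordable at first order, fatal at rate grade.  The cubic remainder at `u` minus the one at `1` is in
truth `O(τ_u·τ³)` (everything is smooth in `u` and equal at `u = 1`).  This file proves the quaternion bookkeeping for that: second differences of the product of the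
four near-identity factors of the transported step `X_p(W;U) = W₁·(P₁W₂P₁⁻¹)·(P₂W₃P₂⁻¹)⁻¹·(hol W₄ hol⁻¹)⁻¹` when the transports `P₁, P₂, hol` of `U = constLift u`
(`u_i`, `u_iu_ju_i⁻¹`, the commutator) replace those of `U = 1` (all `= 1`).
* §1 ★ `vecPart_mul_second_diff` — two factors: the remainder `vecPart(AB) − a − b` and the scalar part `u₀(AB)` are Lipschitz in the factors with constants LINEAR in the sizes;
* §2 ★ `prod4_second_diff` — four factors with equal scalar parts and displaced vector parts (`|a'_i − a_i|_c ≤ δ`, sizes `≤ s ≤ 1/10`): remainder moves by `≤ 53·s·δ`, scalar part by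
  `≤ 54·s·δ`;
* §3 ★★ `transportStep_constLift_second_diff` — for a step `W` (`u₀ ≥ 0`, `|w_{e,c}| ≤ τ ≤ 1/30`) and `|u⃗_{k,a}| ≤ t ≤ 1/40`: componentwise
  `|[vecPart X_p(W;constLift u) − (D_u w)_p] − [vecPart X_p(W;1) − (D_1 w)_p]| ≤ 3339·t·τ²`, `|u₀ X_p(W;constLift u) − u₀ X_p(W;1)| ≤ 3402·t·τ²`, `|(D_u w)_p − (D_1 w)_p| ≤ 63·t·τ`.
HONEST FRAMING: quaternion algebra (componentwise real inequalities on top of lane A/B's exact identities `vecPart_mul_sub`, `one_sub_scalarPart_mul`, `transports_constLift`);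
femto rung R2b1 (RECORD label); not infinite volume, not a gap, not Clay.  No defs, no named facts, no `sorry`.
-/

set_option autoImplicit false

noncomputable section

open scoped Matrix BigOperators
open Literature.MathematicalPhysics.QuantumFieldTheory
open Literature.MathematicalPhysics.QuantumLattice

namespace Summit.QuantumFields.YangMills.Theorems.FemtoTransferGap.RateTube

open Summit.QuantumFields.YangMills.Theorems.FemtoTransferGap
open Summit.QuantumFields.YangMills.Theorems.FemtoTransferGap.TwoLattice
open Summit.QuantumFields.YangMills.Theorems.FemtoTransferGap.TwoLattice.Stiff
open Summit.QuantumFields.YangMills.Theorems.FemtoTransferGap.TwoLattice.Cov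
open Summit.QuantumFields.YangMills.Theorems.FemtoTransferGap.TwoLattice.ConstTube
open Summit.QuantumFields.YangMills.Theorems.FemtoTransferGap.TwoLattice.Toron

variable {L : ℕ} [NeZero L]

/-! ## §1 ★ Two factors: second differences -/

/-- ★ **Two near-identity factors, second difference.**  For `A, A', B, B'` in the upper hemisphere with `|a_c|, |a'_c| ≤ α`, `|b_c|, |b'_c| ≤ β`, displacements `|a'_c − a_c| ≤ δ_a`,
`|b'_c − b_c| ≤ δ_b` and scalar displacements `|u₀A' − u₀A| ≤ ε_a`, `|u₀B' − u₀B| ≤ ε_b`: the remainder `R(A,B) = vecPart(AB) − a − b` satisfies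
`|R(A',B') − R(A,B)|_c ≤ ε_aβ + 3α²δ_b + ε_bα + 3β²δ_a + 2δ_aβ + 2αδ_b` and `|u₀(A'B') − u₀(AB)| ≤ ε_a + ε_b + 3β²ε_a + 3α²ε_b + 3(δ_aβ + αδ_b)`.
[cite: BrockerTomDieck1985, I (1.10)] -/
theorem vecPart_mul_second_diff {A A' B B' : SU2} (hA : 0 ≤ scalarPart A) (hA' : 0 ≤ scalarPart A') (hB : 0 ≤ scalarPart B) (hB' : 0 ≤ scalarPart B')
    {α β δa δb εa εb : ℝ}
    (ha : ∀ i, |vecPart A i| ≤ α) (ha' : ∀ i, |vecPart A' i| ≤ α) (hb : ∀ i, |vecPart B i| ≤ β) (hb' : ∀ i, |vecPart B' i| ≤ β)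
    (hda : ∀ i, |vecPart A' i - vecPart A i| ≤ δa) (hdb : ∀ i, |vecPart B' i - vecPart B i| ≤ δb)
    (hea : |scalarPart A' - scalarPart A| ≤ εa) (heb : |scalarPart B' - scalarPart B| ≤ εb) :
    (∀ c, |(vecPart (A' * B') c - vecPart A' c - vecPart B' c) - (vecPart (A * B) c - vecPart A c - vecPart B c)| ≤
        εa * β + 3 * α ^ 2 * δb + εb * α + 3 * β ^ 2 * δa + 2 * δa * β + 2 * α * δb) ∧
      |scalarPart (A' * B') - scalarPart (A * B)| ≤ εa + εb + (3 * β ^ 2 * εa + 3 * α ^ 2 * εb) + 3 * (δa * β + α * δb) := by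
  have hα : 0 ≤ α := (abs_nonneg _).trans (ha 0)
  have hβ : 0 ≤ β := (abs_nonneg _).trans (hb 0)
  have hδa : 0 ≤ δa := (abs_nonneg _).trans (hda 0)
  have hδb : 0 ≤ δb := (abs_nonneg _).trans (hdb 0)
  have hεa : 0 ≤ εa := (abs_nonneg _).trans hea
  have hεb : 0 ≤ εb := (abs_nonneg _).trans heb
  obtain ⟨hA0, hA1⟩ := one_sub_scalarPart_le_of_abs_le hA ha
  obtain ⟨hA0', hA1'⟩ := one_sub_scalarPart_le_of_abs_le hA' ha'
  obtain ⟨hB0, hB1⟩ := one_sub_scalarPart_le_of_abs_le hB hb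
  obtain ⟨hB0', hB1'⟩ := one_sub_scalarPart_le_of_abs_le hB' hb'
  -- the displaced vectors
  set da : Fin 3 → ℝ := vecPart A' - vecPart A with hdadef
  set db : Fin 3 → ℝ := vecPart B' - vecPart B with hdbdef
  have hda' : ∀ i, |da i| ≤ δa := fun i => by rw [hdadef]; exact hda i
  have hdb' : ∀ i, |db i| ≤ δb := fun i => by rw [hdbdef]; exact hdb i
  have eA' : vecPart A' = vecPart A + da := by rw [hdadef]; abel
  have eB' : vecPart B' = vecPart B + db := by rw [hdbdef]; abel
  -- cross and dot products of the displaced vectors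
  have hcross : ∀ c, |(vecPart A' ⨯₃ vecPart B') c - (vecPart A ⨯₃ vecPart B) c| ≤ 2 * δa * β + 2 * α * δb := fun c => by
    have e : (vecPart A' ⨯₃ vecPart B') c - (vecPart A ⨯₃ vecPart B) c = (da ⨯₃ vecPart B') c + (vecPart A ⨯₃ db) c := by
      rw [eA', eB']
      fin_cases c <;> simp [cross_apply] <;> ring
    rw [e]
    exact (abs_add_le _ _).trans (add_le_add (abs_cross_apply_le hda' hb' c) (abs_cross_apply_le ha hdb' c))
  have hdot : |vecPart A' ⬝ᵥ vecPart B' - vecPart A ⬝ᵥ vecPart B| ≤ 3 * δa * β + 3 * α * δb := by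
    have e : vecPart A' ⬝ᵥ vecPart B' - vecPart A ⬝ᵥ vecPart B = da ⬝ᵥ vecPart B' + vecPart A ⬝ᵥ db := by
      rw [eA', eB']
      simp only [dotProduct, Fin.sum_univ_three, Pi.add_apply]; ring
    rw [e]
    exact (abs_add_le _ _).trans (add_le_add (abs_dot_le hda' hb') (abs_dot_le ha hdb'))
  constructor
  · intro c
    have h1 := congrFun (vecPart_mul_sub A B) c
    have h2 := congrFun (vecPart_mul_sub A' B') c
    simp only [Pi.sub_apply, Pi.add_apply, Pi.smul_apply, smul_eq_mul] at h1 h2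
    rw [h1, h2]
    -- the four scalar-defect terms
    have e : (scalarPart A' - 1) * vecPart B' c + (scalarPart B' - 1) * vecPart A' c + (vecPart A' ⨯₃ vecPart B') c -
        ((scalarPart A - 1) * vecPart B c + (scalarPart B - 1) * vecPart A c + (vecPart A ⨯₃ vecPart B) c) =
        (scalarPart A' - scalarPart A) * vecPart B' c + (scalarPart A - 1) * (vecPart B' c - vecPart B c) +
          (scalarPart B' - scalarPart B) * vecPart A' c + (scalarPart B - 1) * (vecPart A' c - vecPart A c) +
          ((vecPart A' ⨯₃ vecPart B') c - (vecPart A ⨯₃ vecPart B) c) := by ring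
    rw [e]
    have t1 : |(scalarPart A' - scalarPart A) * vecPart B' c| ≤ εa * β := by
      rw [abs_mul]; exact mul_le_mul hea (hb' c) (abs_nonneg _) hεa
    have t2 : |(scalarPart A - 1) * (vecPart B' c - vecPart B c)| ≤ 3 * α ^ 2 * δb := by
      rw [abs_mul, abs_sub_comm (scalarPart A) 1, abs_of_nonneg hA0]; exact mul_le_mul hA1 (hdb c) (abs_nonneg _) (by positivity)
    have t3 : |(scalarPart B' - scalarPart B) * vecPart A' c| ≤ εb * α := by
      rw [abs_mul]; exact mul_le_mul heb (ha' c) (abs_nonneg _) hεb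
    have t4 : |(scalarPart B - 1) * (vecPart A' c - vecPart A c)| ≤ 3 * β ^ 2 * δa := by
      rw [abs_mul, abs_sub_comm (scalarPart B) 1, abs_of_nonneg hB0]; exact mul_le_mul hB1 (hda c) (abs_nonneg _) (by positivity)
    have t5 := hcross c
    have s1 := abs_add_le ((scalarPart A' - scalarPart A) * vecPart B' c + (scalarPart A - 1) * (vecPart B' c - vecPart B c) +
          (scalarPart B' - scalarPart B) * vecPart A' c + (scalarPart B - 1) * (vecPart A' c - vecPart A c))
      ((vecPart A' ⨯₃ vecPart B') c - (vecPart A ⨯₃ vecPart B) c)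
    have s2 := abs_add_le ((scalarPart A' - scalarPart A) * vecPart B' c + (scalarPart A - 1) * (vecPart B' c - vecPart B c) +
          (scalarPart B' - scalarPart B) * vecPart A' c) ((scalarPart B - 1) * (vecPart A' c - vecPart A c))
    have s3 := abs_add_le ((scalarPart A' - scalarPart A) * vecPart B' c + (scalarPart A - 1) * (vecPart B' c - vecPart B c))
          ((scalarPart B' - scalarPart B) * vecPart A' c)
    have s4 := abs_add_le ((scalarPart A' - scalarPart A) * vecPart B' c) ((scalarPart A - 1) * (vecPart B' c - vecPart B c))
    linarith
  · have h1 := one_sub_scalarPart_mul A B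
    have h2 := one_sub_scalarPart_mul A' B'
    have e : scalarPart (A' * B') - scalarPart (A * B) =
        -((1 - scalarPart A') - (1 - scalarPart A)) - ((1 - scalarPart B') - (1 - scalarPart B)) +
          (((1 - scalarPart A') - (1 - scalarPart A)) * (1 - scalarPart B') + (1 - scalarPart A) * ((1 - scalarPart B') - (1 - scalarPart B))) -
          (vecPart A' ⬝ᵥ vecPart B' - vecPart A ⬝ᵥ vecPart B) := by linarith [h1, h2]
    rw [e]
    have u1 : |(1 - scalarPart A') - (1 - scalarPart A)| ≤ εa := by rw [show (1 - scalarPart A') - (1 - scalarPart A) = -(scalarPart A' - scalarPart A) by ring, abs_neg]; exact hea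
    have u2 : |(1 - scalarPart B') - (1 - scalarPart B)| ≤ εb := by rw [show (1 - scalarPart B') - (1 - scalarPart B) = -(scalarPart B' - scalarPart B) by ring, abs_neg]; exact heb
    have u3 : |((1 - scalarPart A') - (1 - scalarPart A)) * (1 - scalarPart B')| ≤ εa * (3 * β ^ 2) := by
      rw [abs_mul, abs_of_nonneg hB0']; exact mul_le_mul u1 hB1' hB0' hεa
    have u4 : |(1 - scalarPart A) * ((1 - scalarPart B') - (1 - scalarPart B))| ≤ 3 * α ^ 2 * εb := by
      rw [abs_mul, abs_of_nonneg hA0]; exact mul_le_mul hA1 u2 (abs_nonneg _) (by positivity)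
    have s1 := abs_sub (-((1 - scalarPart A') - (1 - scalarPart A)) - ((1 - scalarPart B') - (1 - scalarPart B)) +
          (((1 - scalarPart A') - (1 - scalarPart A)) * (1 - scalarPart B') + (1 - scalarPart A) * ((1 - scalarPart B') - (1 - scalarPart B))))
      (vecPart A' ⬝ᵥ vecPart B' - vecPart A ⬝ᵥ vecPart B)
    have s2 := abs_add_le (-((1 - scalarPart A') - (1 - scalarPart A)) - ((1 - scalarPart B') - (1 - scalarPart B)))
          (((1 - scalarPart A') - (1 - scalarPart A)) * (1 - scalarPart B') + (1 - scalarPart A) * ((1 - scalarPart B') - (1 - scalarPart B)))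
    have s3 := abs_sub (-((1 - scalarPart A') - (1 - scalarPart A))) ((1 - scalarPart B') - (1 - scalarPart B))
    have s4 := abs_add_le (((1 - scalarPart A') - (1 - scalarPart A)) * (1 - scalarPart B')) ((1 - scalarPart A) * ((1 - scalarPart B') - (1 - scalarPart B)))
    rw [abs_neg] at s3
    linarith

/-- Size of a displaced vector is unchanged in the hypotheses; a helper: `|x' − x| ≤ δ₁`, `|y' − y| ≤ δ₂`, `|r| ≤ ρ` ⇒ `|(x'+y'+r') − (x+y+r)| ≤ δ₁ + δ₂ + |r' − r|`-type
bookkeeping is done inline below. -/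
theorem abs_sub_le_of_parts {x x' y y' r r' δ₁ δ₂ ρ : ℝ} (hx : |x' - x| ≤ δ₁) (hy : |y' - y| ≤ δ₂) (hr : |r' - r| ≤ ρ) :
    |(x' + y' + r') - (x + y + r)| ≤ δ₁ + δ₂ + ρ := by
  have e : (x' + y' + r') - (x + y + r) = (x' - x) + (y' - y) + (r' - r) := by ring
  rw [e]
  exact (abs_add_le _ _).trans (add_le_add ((abs_add_le _ _).trans (add_le_add hx hy)) hr)

/-! ## §2 ★ Four factors with equal scalar parts and displaced vector parts -/

set_option maxHeartbeats 400000 in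
/-- ★ **Four near-identity factors, second difference.**  `A_i, A'_i` (`i = 1..4`) in the upper hemisphere with `u₀(A'_i) = u₀(A_i)`, `|vecPart(A_i)_c|, |vecPart(A'_i)_c| ≤ s ≤ 1/10`
and `|vecPart(A'_i)_c − vecPart(A_i)_c| ≤ δ`.  Then with `X = A₁(A₂(A₃A₄))`, `X'` likewise: the remainder `vecPart(X) − Σ_i vecPart(A_i)` moves by at most `53·s·δ` per component,
and `|u₀(X') − u₀(X)| ≤ 54·s·δ`. [cite: BrockerTomDieck1985, I (1.10)] -/
theorem prod4_second_diff {A₁ A₂ A₃ A₄ A₁' A₂' A₃' A₄' : SU2}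
    (h₁ : 0 ≤ scalarPart A₁) (h₂ : 0 ≤ scalarPart A₂) (h₃ : 0 ≤ scalarPart A₃) (h₄ : 0 ≤ scalarPart A₄)
    (h₁' : 0 ≤ scalarPart A₁') (h₂' : 0 ≤ scalarPart A₂') (h₃' : 0 ≤ scalarPart A₃') (h₄' : 0 ≤ scalarPart A₄')
    (hs₁ : scalarPart A₁' = scalarPart A₁) (hs₂ : scalarPart A₂' = scalarPart A₂) (hs₃ : scalarPart A₃' = scalarPart A₃) (hs₄ : scalarPart A₄' = scalarPart A₄)
    {s δ : ℝ} (hs : s ≤ 1 / 10) (hδ : 0 ≤ δ)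
    (ha₁ : ∀ i, |vecPart A₁ i| ≤ s) (ha₂ : ∀ i, |vecPart A₂ i| ≤ s) (ha₃ : ∀ i, |vecPart A₃ i| ≤ s) (ha₄ : ∀ i, |vecPart A₄ i| ≤ s)
    (ha₁' : ∀ i, |vecPart A₁' i| ≤ s) (ha₂' : ∀ i, |vecPart A₂' i| ≤ s) (ha₃' : ∀ i, |vecPart A₃' i| ≤ s) (ha₄' : ∀ i, |vecPart A₄' i| ≤ s)
    (hd₁ : ∀ i, |vecPart A₁' i - vecPart A₁ i| ≤ δ) (hd₂ : ∀ i, |vecPart A₂' i - vecPart A₂ i| ≤ δ) (hd₃ : ∀ i, |vecPart A₃' i - vecPart A₃ i| ≤ δ)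
    (hd₄ : ∀ i, |vecPart A₄' i - vecPart A₄ i| ≤ δ) :
    (∀ c, |(vecPart (A₁' * (A₂' * (A₃' * A₄'))) c - (vecPart A₁' c + vecPart A₂' c + vecPart A₃' c + vecPart A₄' c)) -
        (vecPart (A₁ * (A₂ * (A₃ * A₄))) c - (vecPart A₁ c + vecPart A₂ c + vecPart A₃ c + vecPart A₄ c))| ≤ 53 * s * δ) ∧
      |scalarPart (A₁' * (A₂' * (A₃' * A₄'))) - scalarPart (A₁ * (A₂ * (A₃ * A₄)))| ≤ 54 * s * δ := by
  have hs0 : 0 ≤ s := (abs_nonneg _).trans (ha₁ 0)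
  have k1 : s * s ≤ s / 10 := by nlinarith
  have k2 : s * s * s ≤ s * s / 10 := by nlinarith
  have hsδ : 0 ≤ s * δ := mul_nonneg hs0 hδ
  have kd0 : s * δ ≤ 1 / 10 * δ := mul_le_mul_of_nonneg_right hs hδ
  have kd1 : s * s * δ ≤ s * δ / 10 := by
    have := mul_le_mul_of_nonneg_right k1 hδ; linarith
  have kd2 : s * s * s * δ ≤ s * s * δ / 10 := by
    have := mul_le_mul_of_nonneg_right k2 hδ; linarith
  have habs0 : ∀ {x : ℝ}, |x - x| ≤ 0 := fun {x} => by rw [sub_self, abs_zero]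
  -- step 1: `B₁ = A₃A₄`
  have b1 : ∀ c, |vecPart (A₃ * A₄) c| ≤ 3 * s := fun c => by
    have := abs_vecPart_mul_le h₃ h₄ ha₃ ha₄ c; linarith [k1, k2]
  have b1' : ∀ c, |vecPart (A₃' * A₄') c| ≤ 3 * s := fun c => by
    have := abs_vecPart_mul_le h₃' h₄' ha₃' ha₄' c; linarith [k1, k2]
  have s1 : 0 ≤ scalarPart (A₃ * A₄) := by have := (abs_vecPart_mul_sub_le h₃ h₄ ha₃ ha₄).2; linarith [k1]
  have s1' : 0 ≤ scalarPart (A₃' * A₄') := by have := (abs_vecPart_mul_sub_le h₃' h₄' ha₃' ha₄').2; linarith [k1]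
  have he₃ : |scalarPart A₃' - scalarPart A₃| ≤ 0 := by rw [hs₃]; exact habs0
  have he₄ : |scalarPart A₄' - scalarPart A₄| ≤ 0 := by rw [hs₄]; exact habs0
  obtain ⟨d1, e1⟩ := vecPart_mul_second_diff h₃ h₃' h₄ h₄' ha₃ ha₃' ha₄ ha₄' hd₃ hd₄ he₃ he₄
  have e1' : |scalarPart (A₃' * A₄') - scalarPart (A₃ * A₄)| ≤ 6 * s * δ := by linarith [e1]
  have D1 : ∀ c, |vecPart (A₃' * A₄') c - vecPart (A₃ * A₄) c| ≤ 5 / 2 * δ := fun c => by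
    have h := d1 c
    have e : vecPart (A₃' * A₄') c - vecPart (A₃ * A₄) c =
        ((vecPart A₃' c + vecPart A₄' c + (vecPart (A₃' * A₄') c - vecPart A₃' c - vecPart A₄' c)) -
          (vecPart A₃ c + vecPart A₄ c + (vecPart (A₃ * A₄) c - vecPart A₃ c - vecPart A₄ c))) := by ring
    rw [e]
    have := abs_sub_le_of_parts (hd₃ c) (hd₄ c) h
    linarith [kd1, kd0]
  -- step 2: `B₂ = A₂B₁`
  have b2 : ∀ c, |vecPart (A₂ * (A₃ * A₄)) c| ≤ 5 * s := fun c => by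
    have := abs_vecPart_mul_le h₂ s1 ha₂ b1 c; linarith [k1, k2]
  have b2' : ∀ c, |vecPart (A₂' * (A₃' * A₄')) c| ≤ 5 * s := fun c => by
    have := abs_vecPart_mul_le h₂' s1' ha₂' b1' c; linarith [k1, k2]
  have s2 : 0 ≤ scalarPart (A₂ * (A₃ * A₄)) := by have := (abs_vecPart_mul_sub_le h₂ s1 ha₂ b1).2; linarith [k1]
  have s2' : 0 ≤ scalarPart (A₂' * (A₃' * A₄')) := by have := (abs_vecPart_mul_sub_le h₂' s1' ha₂' b1').2; linarith [k1]
  have he₂ : |scalarPart A₂' - scalarPart A₂| ≤ 0 := by rw [hs₂]; exact habs0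
  obtain ⟨d2, e2⟩ := vecPart_mul_second_diff h₂ h₂' s1 s1' ha₂ ha₂' b1 b1' hd₂ D1 he₂ e1'
  have d2' : ∀ c, |(vecPart (A₂' * (A₃' * A₄')) c - vecPart A₂' c - vecPart (A₃' * A₄') c) -
      (vecPart (A₂ * (A₃ * A₄)) c - vecPart A₂ c - vecPart (A₃ * A₄) c)| ≤ 16 * s * δ := fun c => by
    have := d2 c; linarith [kd1]
  have e2' : |scalarPart (A₂' * (A₃' * A₄')) - scalarPart (A₂ * (A₃ * A₄))| ≤ 23 * s * δ := by linarith [e2, kd1, kd2]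
  have D2 : ∀ c, |vecPart (A₂' * (A₃' * A₄')) c - vecPart (A₂ * (A₃ * A₄)) c| ≤ 51 / 10 * δ := fun c => by
    have h := d2' c
    have e : vecPart (A₂' * (A₃' * A₄')) c - vecPart (A₂ * (A₃ * A₄)) c =
        ((vecPart A₂' c + vecPart (A₃' * A₄') c + (vecPart (A₂' * (A₃' * A₄')) c - vecPart A₂' c - vecPart (A₃' * A₄') c)) -
          (vecPart A₂ c + vecPart (A₃ * A₄) c + (vecPart (A₂ * (A₃ * A₄)) c - vecPart A₂ c - vecPart (A₃ * A₄) c))) := by ring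
    rw [e]
    have := abs_sub_le_of_parts (hd₂ c) (D1 c) h
    linarith [kd0]
  -- step 3: `X = A₁B₂`
  have he₁ : |scalarPart A₁' - scalarPart A₁| ≤ 0 := by rw [hs₁]; exact habs0
  obtain ⟨d3, e3⟩ := vecPart_mul_second_diff h₁ h₁' s2 s2' ha₁ ha₁' b2 b2' hd₁ D2 he₁ e2'
  have d3' : ∀ c, |(vecPart (A₁' * (A₂' * (A₃' * A₄'))) c - vecPart A₁' c - vecPart (A₂' * (A₃' * A₄')) c) -
      (vecPart (A₁ * (A₂ * (A₃ * A₄))) c - vecPart A₁ c - vecPart (A₂ * (A₃ * A₄)) c)| ≤ 32 * s * δ := fun c => by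
    have := d3 c; linarith [kd1]
  refine ⟨fun c => ?_, by linarith [e3, kd1, kd2]⟩
  have e : (vecPart (A₁' * (A₂' * (A₃' * A₄'))) c - (vecPart A₁' c + vecPart A₂' c + vecPart A₃' c + vecPart A₄' c)) -
        (vecPart (A₁ * (A₂ * (A₃ * A₄))) c - (vecPart A₁ c + vecPart A₂ c + vecPart A₃ c + vecPart A₄ c)) =
      ((vecPart (A₁' * (A₂' * (A₃' * A₄'))) c - vecPart A₁' c - vecPart (A₂' * (A₃' * A₄')) c) -
          (vecPart (A₁ * (A₂ * (A₃ * A₄))) c - vecPart A₁ c - vecPart (A₂ * (A₃ * A₄)) c)) +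
        ((vecPart (A₂' * (A₃' * A₄')) c - vecPart A₂' c - vecPart (A₃' * A₄') c) -
          (vecPart (A₂ * (A₃ * A₄)) c - vecPart A₂ c - vecPart (A₃ * A₄) c)) +
        ((vecPart (A₃' * A₄') c - vecPart A₃' c - vecPart A₄' c) - (vecPart (A₃ * A₄) c - vecPart A₃ c - vecPart A₄ c)) := by ring
  rw [e]
  have t1 := abs_add_le (((vecPart (A₁' * (A₂' * (A₃' * A₄'))) c - vecPart A₁' c - vecPart (A₂' * (A₃' * A₄')) c) -
          (vecPart (A₁ * (A₂ * (A₃ * A₄))) c - vecPart A₁ c - vecPart (A₂ * (A₃ * A₄)) c)) +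
        ((vecPart (A₂' * (A₃' * A₄')) c - vecPart A₂' c - vecPart (A₃' * A₄') c) -
          (vecPart (A₂ * (A₃ * A₄)) c - vecPart A₂ c - vecPart (A₃ * A₄) c)))
    ((vecPart (A₃' * A₄') c - vecPart A₃' c - vecPart A₄' c) - (vecPart (A₃ * A₄) c - vecPart A₃ c - vecPart A₄ c))
  have t2 := abs_add_le ((vecPart (A₁' * (A₂' * (A₃' * A₄'))) c - vecPart A₁' c - vecPart (A₂' * (A₃' * A₄')) c) -
          (vecPart (A₁ * (A₂ * (A₃ * A₄))) c - vecPart A₁ c - vecPart (A₂ * (A₃ * A₄)) c))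
        ((vecPart (A₂' * (A₃' * A₄')) c - vecPart A₂' c - vecPart (A₃' * A₄') c) -
          (vecPart (A₂ * (A₃ * A₄)) c - vecPart A₂ c - vecPart (A₃ * A₄) c))
  linarith [d1 c, d2' c, d3' c, kd1]


/-! ## §3 ★★ The transported step on the slow manifold versus the vacuum -/

/-- The three transports of `constLift u` at a plaquette in the `(i,j)` plane, `P ∈ {u_i, u_iu_ju_i⁻¹, u_iu_ju_i⁻¹u_j⁻¹}`, move a vector with `|w_b| ≤ τ` by at most `21·t·τ` per
component when `|u⃗_{k,a}| ≤ t ≤ 1/40` (`|(Ad(P)w − w)_c| ≤ 4σρ + 8σ²ρ` with `σ ≤ t, 3t, 4.15t`). [folklore] -/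
theorem transports_constLift_displacement (u : GaugeConfig 3 1 SU2) {t : ℝ} (ht : t ≤ 1 / 40) (hu : ∀ (k : Fin 3) (a : Fin 3), |vecPart (u (0, k)) a| ≤ t)
    (i j : Fin 3) {w : Fin 3 → ℝ} {τ : ℝ} (hw : ∀ b, |w b| ≤ τ) (c : Fin 3) :
    |(adRot (u (0, i)) *ᵥ w - w) c| ≤ 21 * t * τ ∧
      |(adRot (u (0, i) * u (0, j) * (u (0, i))⁻¹) *ᵥ w - w) c| ≤ 21 * t * τ ∧
      |(adRot (u (0, i) * u (0, j) * (u (0, i))⁻¹ * (u (0, j))⁻¹) *ᵥ w - w) c| ≤ 21 * t * τ := by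
  have ht0 : 0 ≤ t := (abs_nonneg _).trans (hu 0 0)
  have hτ0 : 0 ≤ τ := (abs_nonneg _).trans (hw 0)
  have htτ : 0 ≤ t * τ := mul_nonneg ht0 hτ0
  have k1 : t * t * τ ≤ t * τ / 40 := by
    have := mul_le_mul_of_nonneg_right (mul_le_mul_of_nonneg_left ht ht0) hτ0; linarith
  -- sizes of the three transports
  have hP2 : ∀ b, |vecPart (u (0, i) * u (0, j) * (u (0, i))⁻¹) b| ≤ 3 * t := fun b => by
    rw [vecPart_conj]; exact abs_adRot_mulVec_le _ (hu j) b
  have hP3 : ∀ b, |vecPart (u (0, i) * u (0, j) * (u (0, i))⁻¹ * (u (0, j))⁻¹) b| ≤ 83 / 20 * t := fun b => by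
    rw [vecPart_mul, vecPart_inv, scalarPart_inv]
    have hneg : ∀ b', |(-vecPart (u (0, j))) b'| ≤ t := fun b' => by rw [Pi.neg_apply, abs_neg]; exact hu j b'
    have h1 : |scalarPart (u (0, i) * u (0, j) * (u (0, i))⁻¹) * (-vecPart (u (0, j))) b| ≤ t := by
      rw [abs_mul]
      calc |scalarPart (u (0, i) * u (0, j) * (u (0, i))⁻¹)| * |(-vecPart (u (0, j))) b| ≤ 1 * t :=
            mul_le_mul (abs_scalarPart_le _) (hneg b) (abs_nonneg _) zero_le_one
        _ = t := one_mul t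
    have h2 : |scalarPart (u (0, j)) * vecPart (u (0, i) * u (0, j) * (u (0, i))⁻¹) b| ≤ 3 * t := by
      rw [abs_mul]
      calc |scalarPart (u (0, j))| * |vecPart (u (0, i) * u (0, j) * (u (0, i))⁻¹) b| ≤ 1 * (3 * t) :=
            mul_le_mul (abs_scalarPart_le _) (hP2 b) (abs_nonneg _) zero_le_one
        _ = 3 * t := one_mul _
    have h3 := abs_cross_apply_le hP2 hneg b
    have k0 : t * t ≤ t / 40 := by nlinarith
    simp only [Pi.add_apply, Pi.smul_apply, smul_eq_mul]
    have s1 := abs_add_le (scalarPart (u (0, i) * u (0, j) * (u (0, i))⁻¹) * (-vecPart (u (0, j))) b + scalarPart (u (0, j)) * vecPart (u (0, i) * u (0, j) * (u (0, i))⁻¹) b)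
      ((vecPart (u (0, i) * u (0, j) * (u (0, i))⁻¹) ⨯₃ (-vecPart (u (0, j)))) b)
    have s2 := abs_add_le (scalarPart (u (0, i) * u (0, j) * (u (0, i))⁻¹) * (-vecPart (u (0, j))) b) (scalarPart (u (0, j)) * vecPart (u (0, i) * u (0, j) * (u (0, i))⁻¹) b)
    nlinarith [s1, s2, h1, h2, h3, k0]
  refine ⟨?_, ?_, ?_⟩
  · have h := abs_adRot_mulVec_sub_le (hu i) hw c
    nlinarith [k1]
  · have h := abs_adRot_mulVec_sub_le hP2 hw c
    nlinarith [k1]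
  · have h := abs_adRot_mulVec_sub_le hP3 hw c
    nlinarith [k1]

set_option maxHeartbeats 800000 in
omit [NeZero L] in
/-- ★★ **THE TRANSPORTED STEP ON THE SLOW MANIFOLD VERSUS THE VACUUM.**  For a kinetic step `W` in the upper hemisphere with `|vecPart(W_e)_c| ≤ τ ≤ 1/30` and a slow datum with
`|u⃗_{k,a}| ≤ t ≤ 1/40`, at every plaquette `p`: the anharmonic remainder `vecPart X_p(W;U) − (D_U w)_p` of the transported step changes by at most `3339·t·τ²` per component
between `U = constLift u` and `U = 1`, the scalar part `u₀(X_p)` by at most `3402·t·τ²`, and the covariant curl `(D_U w)_p` by at most `63·t·τ` (`w = linkVec W`).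
[cite: Luscher1983, §3] [cite: BrockerTomDieck1985, I (1.10)] -/
theorem transportStep_constLift_second_diff (u : GaugeConfig 3 1 SU2) (W : GaugeConfig 3 L SU2) {τ t : ℝ} (hτ : τ ≤ 1 / 30) (ht : t ≤ 1 / 40)
    (hs : ∀ e : Edge 3 L, 0 ≤ scalarPart (W e)) (hw : ∀ (e : Edge 3 L) (c : Fin 3), |vecPart (W e) c| ≤ τ)
    (hu : ∀ (k : Fin 3) (a : Fin 3), |vecPart (u (0, k)) a| ≤ t) (p : Plaquette 3 L) :
    (∀ c, |(vecPart (transportStep W (constLift L u) p) c - covCurl (constLift L u) (linkVec L W) (p, c)) -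
        (vecPart (transportStep W 1 p) c - covCurl 1 (linkVec L W) (p, c))| ≤ 3339 * t * τ ^ 2) ∧
      |scalarPart (transportStep W (constLift L u) p) - scalarPart (transportStep W 1 p)| ≤ 3402 * t * τ ^ 2 ∧
      (∀ c, |covCurl (constLift L u) (linkVec L W) (p, c) - covCurl 1 (linkVec L W) (p, c)| ≤ 63 * t * τ) := by
  obtain ⟨x, ij⟩ := p
  have hτ0 : 0 ≤ τ := (abs_nonneg _).trans (hw (x, ij.1.1) 0)
  have ht0 : 0 ≤ t := (abs_nonneg _).trans (hu 0 0)
  obtain ⟨hP1, hP2, hP3⟩ := transports_constLift (L := L) u x ij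
  set U := constLift L u with hU
  -- the factors (vacuum ones first, so that the later abbreviations do not rewrite them)
  have hX : transportStep W 1 (x, ij) = W (x, ij.1.1) * (W (x.shift ij.1.1, ij.1.2) * ((W (x.shift ij.1.2, ij.1.1))⁻¹ * (W (x, ij.1.2))⁻¹)) := by
    rw [transportStep_one]
    simp only [hol, plaquetteHolonomy, mul_assoc]
  have hX' : transportStep W U (x, ij) = W (x, ij.1.1) * ((ptrans1 U (x, ij) * W (x.shift ij.1.1, ij.1.2) * (ptrans1 U (x, ij))⁻¹) *
      ((ptrans2 U (x, ij) * W (x.shift ij.1.2, ij.1.1) * (ptrans2 U (x, ij))⁻¹)⁻¹ * (hol U (x, ij) * W (x, ij.1.2) * (hol U (x, ij))⁻¹)⁻¹)) := by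
    simp only [transportStep, mul_assoc]
  set A₃ := (W (x.shift ij.1.2, ij.1.1))⁻¹ with hA₃
  set A₄ := (W (x, ij.1.2))⁻¹ with hA₄
  set A₂' := ptrans1 U (x, ij) * W (x.shift ij.1.1, ij.1.2) * (ptrans1 U (x, ij))⁻¹ with hA₂'
  set A₃' := (ptrans2 U (x, ij) * W (x.shift ij.1.2, ij.1.1) * (ptrans2 U (x, ij))⁻¹)⁻¹ with hA₃'
  set A₄' := (hol U (x, ij) * W (x, ij.1.2) * (hol U (x, ij))⁻¹)⁻¹ with hA₄'
  set A₁ := W (x, ij.1.1) with hA₁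
  set A₂ := W (x.shift ij.1.1, ij.1.2) with hA₂
  -- hemisphere and scalar parts
  have h₁ : 0 ≤ scalarPart A₁ := hs _
  have h₂ : 0 ≤ scalarPart A₂ := hs _
  have h₃ : 0 ≤ scalarPart A₃ := by rw [hA₃, scalarPart_inv]; exact hs _
  have h₄ : 0 ≤ scalarPart A₄ := by rw [hA₄, scalarPart_inv]; exact hs _
  have h₂' : 0 ≤ scalarPart A₂' := (conj_factor_bounds _ _ (hs _) (hw _)).1
  have h₃' : 0 ≤ scalarPart A₃' := (conj_inv_factor_bounds _ _ (hs _) (hw _)).1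
  have h₄' : 0 ≤ scalarPart A₄' := (conj_inv_factor_bounds _ _ (hs _) (hw _)).1
  have hs₂ : scalarPart A₂' = scalarPart A₂ := by rw [hA₂', scalarPart_conj]
  have hs₃ : scalarPart A₃' = scalarPart A₃ := by rw [hA₃', hA₃, scalarPart_inv, scalarPart_inv, scalarPart_conj]
  have hs₄ : scalarPart A₄' = scalarPart A₄ := by rw [hA₄', hA₄, scalarPart_inv, scalarPart_inv, scalarPart_conj]
  -- sizes `≤ 3τ`
  have hτ3 : ∀ {e : Edge 3 L} (c : Fin 3), |vecPart (W e) c| ≤ 3 * τ := fun {e} c => (hw e c).trans (by linarith)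
  have ha₁ : ∀ c, |vecPart A₁ c| ≤ 3 * τ := fun c => hτ3 c
  have ha₂ : ∀ c, |vecPart A₂ c| ≤ 3 * τ := fun c => hτ3 c
  have ha₃ : ∀ c, |vecPart A₃ c| ≤ 3 * τ := fun c => by rw [hA₃, vecPart_inv, Pi.neg_apply, abs_neg]; exact hτ3 c
  have ha₄ : ∀ c, |vecPart A₄ c| ≤ 3 * τ := fun c => by rw [hA₄, vecPart_inv, Pi.neg_apply, abs_neg]; exact hτ3 c
  have ha₂' : ∀ c, |vecPart A₂' c| ≤ 3 * τ := (conj_factor_bounds _ _ (hs _) (hw _)).2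
  have ha₃' : ∀ c, |vecPart A₃' c| ≤ 3 * τ := (conj_inv_factor_bounds _ _ (hs _) (hw _)).2
  have ha₄' : ∀ c, |vecPart A₄' c| ≤ 3 * τ := (conj_inv_factor_bounds _ _ (hs _) (hw _)).2
  -- displacements `≤ 21tτ`
  have hd₁ : ∀ c, |vecPart A₁ c - vecPart A₁ c| ≤ 21 * t * τ := fun c => by rw [sub_self, abs_zero]; positivity
  have hd₂ : ∀ c, |vecPart A₂' c - vecPart A₂ c| ≤ 21 * t * τ := fun c => by
    rw [hA₂', hA₂, vecPart_conj, hP1, ← Pi.sub_apply]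
    exact (transports_constLift_displacement u ht hu ij.1.1 ij.1.2 (hw (x.shift ij.1.1, ij.1.2)) c).1
  have hd₃ : ∀ c, |vecPart A₃' c - vecPart A₃ c| ≤ 21 * t * τ := fun c => by
    rw [hA₃', hA₃, vecPart_conj_inv, vecPart_inv, hP2]
    have h := (transports_constLift_displacement u ht hu ij.1.1 ij.1.2 (hw (x.shift ij.1.2, ij.1.1)) c).2.1
    have e : (-(adRot (u (0, ij.1.1) * u (0, ij.1.2) * (u (0, ij.1.1))⁻¹) *ᵥ vecPart (W (x.shift ij.1.2, ij.1.1)))) c - (-vecPart (W (x.shift ij.1.2, ij.1.1))) c =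
        -((adRot (u (0, ij.1.1) * u (0, ij.1.2) * (u (0, ij.1.1))⁻¹) *ᵥ vecPart (W (x.shift ij.1.2, ij.1.1)) - vecPart (W (x.shift ij.1.2, ij.1.1))) c) := by
      simp only [Pi.neg_apply, Pi.sub_apply]; ring
    rw [e, abs_neg]
    exact h
  have hd₄ : ∀ c, |vecPart A₄' c - vecPart A₄ c| ≤ 21 * t * τ := fun c => by
    rw [hA₄', hA₄, vecPart_conj_inv, vecPart_inv, hP3]
    have h := (transports_constLift_displacement u ht hu ij.1.1 ij.1.2 (hw (x, ij.1.2)) c).2.2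
    have e : (-(adRot (u (0, ij.1.1) * u (0, ij.1.2) * (u (0, ij.1.1))⁻¹ * (u (0, ij.1.2))⁻¹) *ᵥ vecPart (W (x, ij.1.2)))) c - (-vecPart (W (x, ij.1.2))) c =
        -((adRot (u (0, ij.1.1) * u (0, ij.1.2) * (u (0, ij.1.1))⁻¹ * (u (0, ij.1.2))⁻¹) *ᵥ vecPart (W (x, ij.1.2)) - vecPart (W (x, ij.1.2))) c) := by
      simp only [Pi.neg_apply, Pi.sub_apply]; ring
    rw [e, abs_neg]
    exact h
  -- the four-factor lemma with `s = 3τ`, `δ = 21tτ`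
  have hs3 : 3 * τ ≤ 1 / 10 := by linarith
  have hδ0 : 0 ≤ 21 * t * τ := by positivity
  obtain ⟨R, S⟩ := prod4_second_diff h₁ h₂ h₃ h₄ h₁ h₂' h₃' h₄' rfl hs₂ hs₃ hs₄ hs3 hδ0 ha₁ ha₂ ha₃ ha₄ ha₁ ha₂' ha₃' ha₄' hd₁ hd₂ hd₃ hd₄
  -- the linear parts are the covariant curls
  have hlin' : ∀ c, vecPart A₁ c + vecPart A₂' c + vecPart A₃' c + vecPart A₄' c = covCurl U (linkVec L W) ((x, ij), c) := fun c =>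
    sum_vecPart_factors_eq_covCurl W U (x, ij) c
  have hlin : ∀ c, vecPart A₁ c + vecPart A₂ c + vecPart A₃ c + vecPart A₄ c = covCurl 1 (linkVec L W) ((x, ij), c) := fun c => by
    rw [covCurl_one_apply, hA₁, hA₂, hA₃, hA₄, vecPart_inv, vecPart_inv]
    simp only [linkVec_apply, Pi.neg_apply]
    ring
  refine ⟨fun c => ?_, ?_, fun c => ?_⟩
  · rw [hX', hX, ← hlin' c, ← hlin c]
    have h := R c
    have e : (53 : ℝ) * (3 * τ) * (21 * t * τ) = 3339 * t * τ ^ 2 := by ring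
    rw [e] at h
    exact h
  · rw [hX', hX]
    have e : (54 : ℝ) * (3 * τ) * (21 * t * τ) = 3402 * t * τ ^ 2 := by ring
    rw [e] at S
    exact S
  · rw [← hlin' c, ← hlin c]
    have e : vecPart A₁ c + vecPart A₂' c + vecPart A₃' c + vecPart A₄' c - (vecPart A₁ c + vecPart A₂ c + vecPart A₃ c + vecPart A₄ c) =
        (vecPart A₂' c - vecPart A₂ c) + (vecPart A₃' c - vecPart A₃ c) + (vecPart A₄' c - vecPart A₄ c) := by ring
    rw [e]
    have := abs_add_le ((vecPart A₂' c - vecPart A₂ c) + (vecPart A₃' c - vecPart A₃ c)) (vecPart A₄' c - vecPart A₄ c)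
    have := abs_add_le (vecPart A₂' c - vecPart A₂ c) (vecPart A₃' c - vecPart A₃ c)
    linarith [hd₂ c, hd₃ c, hd₄ c]

end Summit.QuantumFields.YangMills.Theorems.FemtoTransferGap.RateTube

end
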